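import Summits.CriticalPhenomena.PercolationContinuityZ3.Theorems.PercNearOneGluingNoHeavyLowerTailSahiClassTCoreReduction
import Mathlib.Tactic.Linarith
import Mathlib.Tactic.Ring
import HarnessLib

/-!
# `NoHeavyLowerTail` (crux stmt-CriticalPhenomena-4575), P2 — the open core, II: **Kahn's Conjecture 5 follows from ONE Bernstein-good essential coordinate
# on every CORE triple** (master-conj's BGC programme restricted to the core)

Support file (seat `prim-masterthm-p2`, gen 14; `--supports stmt-CriticalPhenomena-4575`).  No definition, no `sorry`, standard axioms.
Companion of `…SahiClassTCoreReduction` (same induction on the total essential support, with a disjunctive end-case).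

master-conj (`SahiMasterFamilyBernsteinGoodCoordinate.masterFamilyNonneg_three_of_bernsteinGoodCoordinate`) derives `C_3` from "EVERY triple has, in every
nonempty determining set, a coordinate whose two mixed Bernstein coefficients `mixC1, mixC2` are `≥ 0`".  After class T (`SahiClassTCube.mixC_nonneg_of_classT`: all
coordinates of a class-T triple are good), canalyzing peeling and the private-coordinate affine fibre, the hypothesis is only needed on CORE triples, and only for ONE
ESSENTIAL coordinate:

* `sahiE_three_nonneg_of_core_or_good` — fixed cube and parameter: if every core triple EITHER has `E_3(μ_p) ≥ 0` OR has an essential coordinate `e` with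
  `mixC1_e(p), mixC2_e(p) ≥ 0`, then every triple of increasing events has `E_3(μ_p) ≥ 0`.
* **`masterFamilyNonneg_three_of_core_goodCoordinate`** — `MasterFamilyNonneg 3` (⟺ `KahnConjecture`) follows from: every CORE triple (a coordinate essential to all three
  members, no canalyzing and no private essential coordinate) has, at every `p`, SOME essential coordinate with both mixed Bernstein coefficients `≥ 0`.
  (Census: at `k = 5` EVERY coordinate of EVERY triple is good — ttrl mtp2 T3.md §3/§5, exhaustive, all `p`.)
HONEST FRAMING: a reduction; the hypothesis (BGC on the core) and `C_3` remain OPEN. [this work]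
-/

noncomputable section

open scoped Classical

namespace Summit.CriticalPhenomena.PercolationContinuityZ3.Theorems

namespace SahiClassTCube

open Finset Function
open Literature.Combinatorics.Sahi2008
open Literature.Probability.Percolation.DecisionTree (ind ind_of_mem ind_of_not_mem ind_nonneg)
open Literature.Probability.LatticeModels.Kahn2022 (Affects)

variable {κ : Type} [Fintype κ]

/-- **`C_3` from "positivity OR a good essential coordinate" on CORE triples** (fixed cube `κ`, fixed parameter `p`; the induction of
`sahiE_three_nonneg_of_core` with a disjunctive end-case). [this work] -/
theorem sahiE_three_nonneg_of_core_or_good (p : κ → unitInterval)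
    (hcore : ∀ U : Fin 3 → Set (Set κ), (∀ j, IsUpperSet (U j)) →
      (∃ x, x ∈ esupp (U 0) ∧ x ∈ esupp (U 1) ∧ x ∈ esupp (U 2)) →
      (∀ j x, x ∈ esupp (U j) → ¬ ({ω : Set κ | x ∈ ω} ⊆ U j) ∧ ¬ (U j ⊆ {ω : Set κ | x ∈ ω})) →
      (∀ j x, x ∈ esupp (U j) → ∃ j', j' ≠ j ∧ x ∈ esupp (U j')) →
      0 ≤ sahiE (bernoulliWeight p) 3 (fun j => ind (U j)) ∨
        ∃ (e : κ) (j : Fin 3), e ∈ esupp (U j) ∧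
          0 ≤ SahiCombMix.mixC1 (bernoulliWeight p) (fun i => secAt e false (U i)) (fun i => secAt e true (U i)) ∧
          0 ≤ SahiCombMix.mixC2 (bernoulliWeight p) (fun i => secAt e false (U i)) (fun i => secAt e true (U i)))
    (U : Fin 3 → Set (Set κ)) (hU : ∀ j, IsUpperSet (U j)) :
    0 ≤ sahiE (bernoulliWeight p) 3 (fun j => ind (U j)) := by
  suffices key : ∀ (N : ℕ) (V : Fin 3 → Set (Set κ)), (∑ i, (esupp (V i)).card) ≤ N → (∀ j, IsUpperSet (V j)) →
      0 ≤ sahiE (bernoulliWeight p) 3 (fun j => ind (V j)) from key _ U le_rfl hU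
  intro N
  induction N with
  | zero =>
    -- no essential coordinates at all: class T
    intro V hN hV
    refine sahiE_three_nonneg_of_classT' V hV (fun x hx => ?_) p
    have h0 : (esupp (V 0)).card = 0 := by
      have := Finset.single_le_sum (f := fun i => (esupp (V i)).card) (fun i _ => Nat.zero_le _) (Finset.mem_univ (0 : Fin 3))
      omega
    rw [Finset.card_eq_zero] at h0
    simpa [h0] using hx.1
  | succ N ih =>
    intro V hN hV
    -- sections and their support
    have hVsec : ∀ (x : κ) (b : Bool) (j : Fin 3), IsUpperSet (secAt x b (V j)) := fun x b j => isUpperSet_secAt x b (hV j)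
    have ihsec : ∀ (x : κ) (b : Bool) (j : Fin 3), x ∈ esupp (V j) →
        0 ≤ sahiE (bernoulliWeight p) 3 (fun i => ind (secAt x b (V i))) := by
      intro x b j hx
      refine ih (fun i => secAt x b (V i)) ?_ (hVsec x b)
      have := sum_card_esupp_secAt_lt V hV hx b
      omega
    -- the same for a re-indexed triple
    have ihsecσ : ∀ (σ : Equiv.Perm (Fin 3)) (x : κ) (b : Bool) (j : Fin 3), x ∈ esupp (V (σ j)) →
        0 ≤ sahiE (bernoulliWeight p) 3 (fun i => ind (secAt x b (V (σ i)))) := by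
      intro σ x b j hx
      rw [sahiE_three_ind_comp_perm (bernoulliWeight p) σ (fun i => secAt x b (V i))]
      exact ihsec x b (σ j) hx
    by_cases hT : ∃ x, x ∈ esupp (V 0) ∧ x ∈ esupp (V 1) ∧ x ∈ esupp (V 2)
    swap
    · -- class T
      push Not at hT
      exact sahiE_three_nonneg_of_classT' V hV (fun x hx => hT x hx.1 hx.2.1 hx.2.2) p
    by_cases himp : ∃ (j : Fin 3) (x : κ), x ∈ esupp (V j) ∧ {ω : Set κ | x ∈ ω} ⊆ V j
    · -- an implied coordinate: inherit from the `0`-sections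
      obtain ⟨j, x, hx, hsub⟩ := himp
      let σ : Equiv.Perm (Fin 3) := Equiv.swap 0 j
      have hσ : σ 0 = j := by simp [σ]
      rw [← sahiE_three_ind_comp_perm (bernoulliWeight p) σ V]
      have h := SahiCoordinateGluing.sahiE_three_nonneg_of_coordEvent_subset_member p x (hV (σ 0)) (hV (σ 1)) (hV (σ 2))
        (by rw [hσ]; exact hsub) (by
          rw [Pointwise.ind_vec3, ← Pointwise.ind_vec3, vec3_eta (fun i => secAt x false (V (σ i)))]
          exact ihsecσ σ x false 0 (by rw [hσ]; exact hx))
      rw [vec3_eta (fun i => V (σ i))] at h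
      exact h
    by_cases hreq : ∃ (j : Fin 3) (x : κ), x ∈ esupp (V j) ∧ V j ⊆ {ω : Set κ | x ∈ ω}
    · -- a required coordinate: inherit from the `1`-sections
      obtain ⟨j, x, hx, hsub⟩ := hreq
      let σ : Equiv.Perm (Fin 3) := Equiv.swap 2 j
      have hσ : σ 2 = j := by simp [σ]
      rw [← sahiE_three_ind_comp_perm (bernoulliWeight p) σ V]
      have hCe : ∀ b : Bool, secAt x b (secAt x true (V (σ 2))) = secAt x true (V (σ 2)) := fun b => Pointwise.secAt_secAt_same x b true _
      have h := Pointwise.sahiE_three_interCoord_nonneg p x (hV (σ 0)) (hV (σ 1)) (hVsec x true (σ 2)) hCe (by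
        rw [Pointwise.ind_vec3, ← Pointwise.ind_vec3, vec3_eta (fun i => secAt x true (V (σ i)))]
        exact ihsecσ σ x true 2 (by rw [hσ]; exact hx))
      rw [secAt_true_inter_coordEvent_of_subset x (by rw [hσ]; exact hsub), vec3_eta (fun i => V (σ i))] at h
      exact h
    by_cases hpriv : ∃ (j : Fin 3) (x : κ), x ∈ esupp (V j) ∧ ∀ j', j' ≠ j → x ∉ esupp (V j')
    · -- a private coordinate: the fibre is affine, both sections are smaller
      obtain ⟨j, x, hx, hnot⟩ := hpriv
      let σ : Equiv.Perm (Fin 3) := Equiv.swap 0 j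
      have hσ : σ 0 = j := by simp [σ]
      rw [← sahiE_three_ind_comp_perm (bernoulliWeight p) σ V]
      have hVσ : ∀ i, IsUpperSet (V (σ i)) := fun i => hV (σ i)
      rw [Pointwise.sahiE_three_bernstein_secAt x (fun i => V (σ i)) hVσ p]
      have hfree : ∀ i : Fin 3, i ≠ 0 → ∀ b : Bool, secAt x b (V (σ i)) = V (σ i) := by
        intro i hi b
        have hne : σ i ≠ j := by
          intro h'
          apply hi
          have : σ i = σ 0 := by rw [h', hσ]
          exact σ.injective this
        exact secAt_eq_self_of_not_affects (hV (σ i)) (fun ha => hnot (σ i) hne (mem_esupp.2 ha)) b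
      have h1 : secAt x true (V (σ 1)) = secAt x false (V (σ 1)) := by rw [hfree 1 (by decide), hfree 1 (by decide)]
      have h2 : secAt x true (V (σ 2)) = secAt x false (V (σ 2)) := by rw [hfree 2 (by decide), hfree 2 (by decide)]
      obtain ⟨e1, e2⟩ := mixC_eq_of_sections_eq (bernoulliWeight p) (fun i => secAt x false (V (σ i))) (fun i => secAt x true (V (σ i))) h1 h2
      rw [e1, e2]
      have E0 := ihsecσ σ x false 0 (by rw [hσ]; exact hx)
      have E1 := ihsecσ σ x true 0 (by rw [hσ]; exact hx)
      have ht0 : 0 ≤ (p x : ℝ) := (p x).2.1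
      have ht1 : 0 ≤ 1 - (p x : ℝ) := sub_nonneg.2 (p x).2.2
      have hm1 : 0 ≤ 2 * sahiE (bernoulliWeight p) 3 (fun i => ind (secAt x false (V (σ i))))
          + sahiE (bernoulliWeight p) 3 (fun i => ind (secAt x true (V (σ i)))) := by linarith
      have hm2 : 0 ≤ sahiE (bernoulliWeight p) 3 (fun i => ind (secAt x false (V (σ i))))
          + 2 * sahiE (bernoulliWeight p) 3 (fun i => ind (secAt x true (V (σ i)))) := by linarith
      have a0 := mul_nonneg (pow_nonneg ht1 3) E0
      have a1 := mul_nonneg (mul_nonneg ht0 (pow_nonneg ht1 2)) hm1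
      have a2 := mul_nonneg (mul_nonneg (pow_nonneg ht0 2) ht1) hm2
      have a3 := mul_nonneg (pow_nonneg ht0 3) E1
      linarith
    -- otherwise the triple is CORE: positivity is given, or a good essential coordinate splits it into two smaller sections
    push Not at himp hreq hpriv
    rcases hcore V hV hT (fun j x hx => ⟨himp j x hx, hreq j x hx⟩) (fun j x hx => by
      obtain ⟨j', hj', hxj'⟩ := hpriv j x hx
      exact ⟨j', hj', by simpa using hxj'⟩) with hpos | ⟨e, j, he, hC1, hC2⟩
    · exact hpos
    · rw [Pointwise.sahiE_three_bernstein_secAt e V hV p]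
      have E0 := ihsec e false j he
      have E1 := ihsec e true j he
      have ht0 : 0 ≤ (p e : ℝ) := (p e).2.1
      have ht1 : 0 ≤ 1 - (p e : ℝ) := sub_nonneg.2 (p e).2.2
      have a0 := mul_nonneg (pow_nonneg ht1 3) E0
      have a1 := mul_nonneg (mul_nonneg ht0 (pow_nonneg ht1 2)) hC1
      have a2 := mul_nonneg (mul_nonneg (pow_nonneg ht0 2) ht1) hC2
      have a3 := mul_nonneg (pow_nonneg ht0 3) E1
      linarith

/-- **KAHN'S CONJECTURE 5 FROM ONE BERNSTEIN-GOOD ESSENTIAL COORDINATE ON EVERY CORE TRIPLE.**  If every CORE triple of increasing events (a coordinate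
essential to all three members; no canalyzing and no private essential coordinate) has, at every parameter, SOME essential coordinate `e` with
`mixC1_e ≥ 0` and `mixC2_e ≥ 0`, then `MasterFamilyNonneg 3` (⟺ `KahnConjecture`).  (master-conj's `masterFamilyNonneg_three_of_bernsteinGoodCoordinate` with the
hypothesis restricted from all triples / all determining sets to the core / one essential coordinate.) [this work] -/
theorem masterFamilyNonneg_three_of_core_goodCoordinate
    (hgood : ∀ (κ : Type) [Fintype κ] (p : κ → unitInterval) (U : Fin 3 → Set (Set κ)), (∀ j, IsUpperSet (U j)) →
      (∃ x, x ∈ esupp (U 0) ∧ x ∈ esupp (U 1) ∧ x ∈ esupp (U 2)) →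
      (∀ j x, x ∈ esupp (U j) → ¬ ({ω : Set κ | x ∈ ω} ⊆ U j) ∧ ¬ (U j ⊆ {ω : Set κ | x ∈ ω})) →
      (∀ j x, x ∈ esupp (U j) → ∃ j', j' ≠ j ∧ x ∈ esupp (U j')) →
      ∃ (e : κ) (j : Fin 3), e ∈ esupp (U j) ∧
        0 ≤ SahiCombMix.mixC1 (bernoulliWeight p) (fun i => secAt e false (U i)) (fun i => secAt e true (U i)) ∧
        0 ≤ SahiCombMix.mixC2 (bernoulliWeight p) (fun i => secAt e false (U i)) (fun i => secAt e true (U i))) :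
    MasterFamilyNonneg 3 := by
  intro κ _ p U hU
  exact sahiE_three_nonneg_of_core_or_good p (fun V hV h1 h2 h3 => Or.inr (hgood κ p V hV h1 h2 h3)) U hU

end SahiClassTCube

end Summit.CriticalPhenomena.PercolationContinuityZ3.Theorems
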